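import Summits.QuantumFields.YangMills.Theorems.BalabanUVNodesN15KingModelBoxBoundaryRate
import Summits.QuantumFields.YangMills.Theorems.BalabanUVNodesN15KingModelBoxNormalisationRate
import HarnessLib

/-!
# BalabanUVNodes ∕ N15 — THE KING-MODEL RUNG (PART Ϟ-i): SHIFTED HALF-GRID SUMS OF A BOUNDED SYMBOL (the telescoping bound, generic), AND THE COORDINATEWISE
# REFLECTION SYMMETRY OF KING's ALIAS SYMBOL (4.5): `Δ^{(K)}(…, −p_μ, …) = Δ^{(K)}(…, p_μ, …)`, whence `Δ^{(K)}(p′(σ_S k̂)) = Δ^{(K)}(π(k+1_S)∕n)`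
# (Track A, DAG node N15 = NE2; FAN-OUT v1.1 §N15 s3 «KING-MODEL RUNG»; King p.670 l.8–13 «free boundary conditions»; count-neutral)

HONEST FRAMING.  Count-neutral (cell `pub-ymgap`, seat `pub-ymgap-dag-n15-e` g41; `--supports stmt-QuantumFields-27366 --as helper` = K3⁸).
TEMPLATE LITERATURE: C. King, Commun. Math. Phys. **102** (1986) 649–677 [King1986]: (4.5) p.670 and (4.12)–(4.13) p.671 (the alias-sum symbol `Δ^{(k)}(p′) = [a_k⁻¹ +
Σ_{l′}|u(p′+l′)|²∕Δ^{η′}(p′+l′)]⁻¹` of the effective Laplacian; tree: `King1986.DeltaEff = (composedInvResc a⁻¹ N M p)⁻¹`, `composedInvResc = c + Σ_m Ur·(DeltaXir∘shiftr)⁻¹`,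
`B4Strip.Ur = Π_μ uFactorr`, `DeltaXir = Σ_μ Sxir + M`), §4 p.670 l.8–13.  Part Ϟ-g bounded the difference between a shifted and an unshifted half-grid sum of the FREE symbol
`ln lapSym` by one telescoped boundary face; parts Ϟ-e∕Ϟ-f tiled the doubled torus's dual by shifted half grids USING `cos`-evenness of the free symbol.  For King's RG
block-field symbol (4.5) the same programme needs the symbol's COORDINATEWISE reflection symmetry — proved here from the alias sum by re-indexing `l_μ ↦ −l_μ (mod N)`.
§1 (generic, any `h : ℝ^{d+1} → ℝ` bounded by `B` on `[0,π]^{d+1}`) def **`boxShiftSum n h S = Σ_{k∈Ω} h(boxShiftPt S k)`**, `boxShiftPt_mem_zone`, `insertNth_mem_zone`,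
★★ **`abs_boxShiftSum_insert_sub_le`** (`μ ∉ S`: `|boxShiftSum (insert μ S) − boxShiftSum S| ≤ 2B·Π_i n_{μ.succAbove i}`, TELESCOPING ONE FACE), ★★ **`abs_boxShiftSum_sub_empty_le`**
(`≤ 2B·(Πn)·Σ_{μ∈S}(n_μ)⁻¹`).
§2 (coordinatewise evenness of (4.5)) `S1r_neg`, `Sxir_neg`, `exists_val_negFin_add`, ★ `Sxir_neg_add_negFin` (`S_ξ(−x + 2π·(−k mod N)) = S_ξ(x + 2πk)`), ★ `uFactorr_negFin_neg`
(`uFactorr N (−k mod N) (−x) = uFactorr N k x`), def-free involution `aliasReflect`, ★★ **`composedInvResc_update_neg`**, ★★ **`DeltaEff_update_neg`**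
(`Δ^{(K)}(update p μ (−p_μ)) = Δ^{(K)}(p)`), ★★ **`DeltaEff_eq_of_abs_eq`** (`|p_μ| = |p′_μ| ∀μ ⇒ Δ^{(K)}(p) = Δ^{(K)}(p′)`).
§3 `natAbs_valMinAbs_torReflS_dblBox`, ★ `abs_sOf_torReflS_dblBox` (`|p′_μ(σ_S k̂)| = π(k_μ+[μ∈S])∕n_μ`), `boxShiftPt_nonneg`, ★★ **`DeltaEff_sOf_torReflS_dblBox`**
(`Δ^{(K)}(p′(σ_S k̂)) = Δ^{(K)}(boxShiftPt S k)` — the block-field symbol on the reflected half grid IS the symbol on the shifted half grid).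

PRIOR TREE ART (named, USED not restated): Ϟ-g (`boxShiftPt`, `boxShiftPt_insertNth_of_not_mem`, `boxShiftPt_insertNth_insert`, `sum_kingBox_eq_sum_insertNth`,
`prod_cast_eq_mul_prod_succAbove`), Ν-a∕Ν-b (`dblBox`, `torReflS`, `dblPer`), `B4Strip` (`S1r`, `Sxir`, `shiftr`, `DeltaXir`, `uFactorr`, `Ur`), `King1986` (`composedInvResc`,
`DeltaEff`), `B5Prop11Plancherel` (`sOf`), Mathlib (`Fin.insertNth`, `Fin.val_add`, `ZMod.natAbs_valMinAbs_neg`, `ZMod.valMinAbs_natCast_of_le_half`, `Real.cos_add_int_mul_two_pi`).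
NOT Bałaban's covariant objects; NOT a node discharge (N15 is booked through n15-a's knit, untouched); nothing continuum-YM ∕ `ℝ⁴` ∕ OS ∕ Clay.  0 `sorry`; 1 plumbing `def`
(`boxShiftSum`).

HONEST SCOPE.  §1 is finite bookkeeping for any bounded function; §2 is an identity of King's printed alias symbol for every `N ≥ 1`, real `a`, `M` (no positivity needed); the
consumer (the block-field free energy density on `Ω`) is part Ϟ-j.  Locators: [King1986] (4.5) p.670, (4.12)–(4.13) p.671, §4 p.670 l.8–13.
-/

noncomputable section

open scoped BigOperators
open Finset

namespace Summit.QuantumFields.YangMills.BalabanUVNodes.N15KingModelRung.TorusSpectral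

open Literature.MathematicalPhysics.QuantumFieldTheory.Balaban1983to89.B5Prop11Plancherel (Tor sOf)
open Literature.MathematicalPhysics.QuantumFieldTheory.Balaban1983to89.B4Strip (S1r Sxir shiftr DeltaXir uFactorr Ur)
open Literature.MathematicalPhysics.QuantumFieldTheory.King1986 (composedInvResc DeltaEff)
open Literature.MathematicalPhysics.QuantumFieldTheory.King1986.Torus

variable {d : ℕ}

/-! ## §1 Shifted half-grid sums of a bounded function: one shifted direction costs one boundary face -/

section Generic

variable (n : Fin (d + 1) → ℕ) (h : (Fin (d + 1) → ℝ) → ℝ)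

/-- THE SHIFTED HALF-GRID SUM of a function `h`: `Σ_{k∈Ω} h((π(k_ν+[ν∈S])∕n_ν)_ν)`. [folklore] -/
def boxShiftSum (S : Finset (Fin (d + 1))) : ℝ := ∑ k : KingBox n, h (boxShiftPt n S k)

omit h in
/-- every shifted half-grid point lies in the closed zone `[0,π]^{d+1}` (`k_ν + [ν∈S] ≤ n_ν`). [folklore] -/
theorem boxShiftPt_mem_zone [hn : ∀ μ, NeZero (n μ)] (S : Finset (Fin (d + 1))) (k : KingBox n) (ν : Fin (d + 1)) :
    0 ≤ boxShiftPt n S k ν ∧ boxShiftPt n S k ν ≤ Real.pi := by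
  have hn0 : (0 : ℝ) < n ν := by exact_mod_cast NeZero.pos (n ν)
  have hk : ((k ν).val : ℝ) + 1 ≤ n ν := by exact_mod_cast (k ν).isLt
  simp only [boxShiftPt]
  constructor
  · apply div_nonneg _ hn0.le
    apply mul_nonneg Real.pi_pos.le
    split_ifs <;> positivity
  · rw [div_le_iff₀ hn0]
    have : ((k ν).val : ℝ) + (if ν ∈ S then (1 : ℝ) else 0) ≤ n ν := by split_ifs <;> linarith
    nlinarith [Real.pi_pos]

omit h in
/-- the telescoped points `insertNth μ (πt∕n_μ) (…)`, `t ∈ {0,…,n_μ}`, lie in the closed zone. [folklore] -/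
theorem insertNth_mem_zone [hn : ∀ μ, NeZero (n μ)] (S : Finset (Fin (d + 1))) (μ : Fin (d + 1)) (r : ∀ i : Fin d, Fin (n (μ.succAbove i))) {t : ℕ} (ht : t ≤ n μ)
    (ν : Fin (d + 1)) :
    0 ≤ Fin.insertNth (α := fun _ => ℝ) μ (Real.pi * (t : ℝ) / n μ) (fun i => Real.pi * ((r i).val + if μ.succAbove i ∈ S then (1 : ℝ) else 0) / n (μ.succAbove i)) ν ∧
      Fin.insertNth (α := fun _ => ℝ) μ (Real.pi * (t : ℝ) / n μ) (fun i => Real.pi * ((r i).val + if μ.succAbove i ∈ S then (1 : ℝ) else 0) / n (μ.succAbove i)) ν ≤ Real.pi := by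
  revert ν
  refine (Fin.forall_iff_succAbove μ).mpr ⟨?_, fun i => ?_⟩
  · rw [Fin.insertNth_apply_same]
    have hn0 : (0 : ℝ) < n μ := by exact_mod_cast NeZero.pos (n μ)
    have ht' : (t : ℝ) ≤ n μ := by exact_mod_cast ht
    refine ⟨by positivity, ?_⟩
    rw [div_le_iff₀ hn0]
    nlinarith [Real.pi_pos]
  · rw [Fin.insertNth_apply_succAbove]
    have hn0 : (0 : ℝ) < n (μ.succAbove i) := by exact_mod_cast NeZero.pos (n (μ.succAbove i))
    have hk : ((r i).val : ℝ) + 1 ≤ n (μ.succAbove i) := by exact_mod_cast (r i).isLt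
    refine ⟨?_, ?_⟩
    · apply div_nonneg _ hn0.le
      apply mul_nonneg Real.pi_pos.le
      split_ifs <;> positivity
    · rw [div_le_iff₀ hn0]
      have : ((r i).val : ℝ) + (if μ.succAbove i ∈ S then (1 : ℝ) else 0) ≤ n (μ.succAbove i) := by split_ifs <;> linarith
      nlinarith [Real.pi_pos]

/-- ★★ **ONE SHIFTED DIRECTION COSTS ONE BOUNDARY FACE** (generic): if `|h| ≤ B` on `[0,π]^{d+1}` and `μ ∉ S`, then
`|boxShiftSum h (insert μ S) − boxShiftSum h S| ≤ 2B·Π_i n_{μ.succAbove i}` (the `μ`-sums telescope). [folklore] -/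
theorem abs_boxShiftSum_insert_sub_le [hn : ∀ μ, NeZero (n μ)] {B : ℝ} (hB : ∀ p : Fin (d + 1) → ℝ, (∀ ν, 0 ≤ p ν ∧ p ν ≤ Real.pi) → |h p| ≤ B) (μ : Fin (d + 1))
    {S : Finset (Fin (d + 1))} (hμ : μ ∉ S) :
    |boxShiftSum n h (insert μ S) - boxShiftSum n h S| ≤ 2 * B * ∏ i : Fin d, (n (μ.succAbove i) : ℝ) := by
  set g : (∀ i : Fin d, Fin (n (μ.succAbove i))) → ℕ → ℝ := fun r t =>
    h (Fin.insertNth μ (Real.pi * (t : ℝ) / n μ) (fun i => Real.pi * ((r i).val + if μ.succAbove i ∈ S then (1 : ℝ) else 0) / n (μ.succAbove i))) with hg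
  have hdiff : boxShiftSum n h (insert μ S) - boxShiftSum n h S = ∑ r : (∀ i : Fin d, Fin (n (μ.succAbove i))), (g r (n μ) - g r 0) := by
    unfold boxShiftSum
    rw [sum_kingBox_eq_sum_insertNth n μ, sum_kingBox_eq_sum_insertNth n μ, ← Finset.sum_sub_distrib]
    refine Finset.sum_congr rfl fun r _ => ?_
    have htel : ∑ x : Fin (n μ), (g r (x.val + 1) - g r x.val) = g r (n μ) - g r 0 := by
      rw [Fin.sum_univ_eq_sum_range (fun t => g r (t + 1) - g r t) (n μ), Finset.sum_range_sub]
    rw [← Finset.sum_sub_distrib, ← htel]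
    refine Finset.sum_congr rfl fun x _ => ?_
    rw [boxShiftPt_insertNth_insert, boxShiftPt_insertNth_of_not_mem n μ hμ, hg]
    push_cast
    rfl
  rw [hdiff]
  refine (Finset.abs_sum_le_sum_abs _ _).trans ?_
  have hterm : ∀ r : (∀ i : Fin d, Fin (n (μ.succAbove i))), |g r (n μ) - g r 0| ≤ 2 * B := by
    intro r
    have h1 : |g r (n μ)| ≤ B := hB _ (insertNth_mem_zone n S μ r le_rfl)
    have h2 : |g r 0| ≤ B := hB _ (insertNth_mem_zone n S μ r (Nat.zero_le _))
    calc |g r (n μ) - g r 0| ≤ |g r (n μ)| + |g r 0| := abs_sub _ _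
      _ ≤ 2 * B := by linarith
  calc ∑ r : (∀ i : Fin d, Fin (n (μ.succAbove i))), |g r (n μ) - g r 0| ≤ ∑ _r : (∀ i : Fin d, Fin (n (μ.succAbove i))), 2 * B := Finset.sum_le_sum fun r _ => hterm r
    _ = 2 * B * ∏ i : Fin d, (n (μ.succAbove i) : ℝ) := by
        rw [Finset.sum_const, Finset.card_univ, Fintype.card_pi, nsmul_eq_mul]
        simp only [Fintype.card_fin]
        push_cast
        ring

/-- ★★ `|boxShiftSum h S − boxShiftSum h ∅| ≤ 2B·(Π_νn_ν)·Σ_{μ∈S}(n_μ)⁻¹` (one face per shifted direction). [folklore] -/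
theorem abs_boxShiftSum_sub_empty_le [hn : ∀ μ, NeZero (n μ)] {B : ℝ} (hB : ∀ p : Fin (d + 1) → ℝ, (∀ ν, 0 ≤ p ν ∧ p ν ≤ Real.pi) → |h p| ≤ B)
    (S : Finset (Fin (d + 1))) :
    |boxShiftSum n h S - boxShiftSum n h ∅| ≤ 2 * B * (∏ ν, (n ν : ℝ)) * ∑ μ ∈ S, ((n μ : ℝ))⁻¹ := by
  induction S using Finset.induction_on with
  | empty => simp
  | insert μ S hμ ih =>
    have hnμ : (0 : ℝ) < n μ := by exact_mod_cast NeZero.pos (n μ)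
    have hface := abs_boxShiftSum_insert_sub_le n h hB μ hμ
    have hprod : (∏ ν, (n ν : ℝ)) * ((n μ : ℝ))⁻¹ = ∏ i : Fin d, (n (μ.succAbove i) : ℝ) := by
      rw [prod_cast_eq_mul_prod_succAbove n μ, mul_comm, ← mul_assoc, inv_mul_cancel₀ hnμ.ne', one_mul]
    rw [Finset.sum_insert hμ, mul_add]
    calc |boxShiftSum n h (insert μ S) - boxShiftSum n h ∅|
        ≤ |boxShiftSum n h (insert μ S) - boxShiftSum n h S| + |boxShiftSum n h S - boxShiftSum n h ∅| := abs_sub_le _ _ _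
      _ ≤ 2 * B * ∏ i : Fin d, (n (μ.succAbove i) : ℝ) + 2 * B * (∏ ν, (n ν : ℝ)) * ∑ μ ∈ S, ((n μ : ℝ))⁻¹ := add_le_add hface ih
      _ = _ := by rw [← hprod]; ring

end Generic

/-! ## §2 The coordinatewise reflection symmetry of King's alias symbol (4.5) -/

section Even

variable {dd : ℕ}

/-- `S₁(−x) = S₁(x)`. [folklore] -/
theorem S1r_neg (x : ℝ) : S1r (-x) = S1r x := by unfold S1r; rw [Real.cos_neg]

/-- `S_ξ(−x) = S_ξ(x)`. [folklore] -/
theorem Sxir_neg (R : ℕ) (x : ℝ) : Sxir R (-x) = Sxir R x := by unfold Sxir; rw [neg_div, Real.cos_neg]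

/-- `(−k mod R) + k = R·t` for some natural `t` (`t ∈ {0,1}`). [folklore] -/
theorem exists_val_negFin_add (R : ℕ) [NeZero R] (k : Fin R) : ∃ t : ℕ, (((-k : Fin R) : ℕ) : ℝ) + (k : ℕ) = (R : ℝ) * t := by
  have h : ((-k + k : Fin R) : ℕ) = 0 := by rw [neg_add_cancel]; simp
  rw [Fin.val_add] at h
  obtain ⟨t, ht⟩ := Nat.dvd_of_mod_eq_zero h
  exact ⟨t, by exact_mod_cast ht⟩

/-- ★ the reflected alias shift: `S_ξ(−x + 2π·(−k mod N)) = S_ξ(x + 2πk)` (`2π`-periodicity of `cos(·∕N)` in steps of `2πN`). [cite: King1986, (4.4)–(4.5) p.670] -/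
theorem Sxir_neg_add_negFin (R : ℕ) [NeZero R] (k : Fin R) (x : ℝ) :
    Sxir R (-x + 2 * Real.pi * ((((-k : Fin R) : ℕ)) : ℝ)) = Sxir R (x + 2 * Real.pi * ((k : ℕ) : ℝ)) := by
  obtain ⟨t, ht⟩ := exists_val_negFin_add R k
  have hR : (R : ℝ) ≠ 0 := by exact_mod_cast NeZero.ne R
  unfold Sxir
  congr 2
  congr 1
  have e : (-x + 2 * Real.pi * ((((-k : Fin R) : ℕ)) : ℝ)) / R = -((x + 2 * Real.pi * ((k : ℕ) : ℝ)) / R) + (t : ℤ) * (2 * Real.pi) := by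
    have : ((((-k : Fin R) : ℕ)) : ℝ) = (R : ℝ) * t - (k : ℕ) := by linarith
    rw [this]
    field_simp
    push_cast
    ring
  rw [e, Real.cos_add_int_mul_two_pi, Real.cos_neg]

/-- ★ the alias weight factor under the reflection: `uFactorr N (−k mod N) (−x) = uFactorr N k x`. [cite: King1986, (4.3)–(4.5) p.670] -/
theorem uFactorr_negFin_neg (R : ℕ) [NeZero R] (k : Fin R) (x : ℝ) : uFactorr R (((-k : Fin R) : ℕ)) (-x) = uFactorr R (k : ℕ) x := by
  by_cases hk : k = 0
  · subst hk
    simp only [neg_zero, Fin.val_zero]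
    unfold uFactorr
    simp only [if_true, neg_eq_zero, S1r_neg, Sxir_neg]
  · have hk' : ((-k : Fin R) : ℕ) ≠ 0 := by
      intro h0
      apply hk
      have : (-k : Fin R) = 0 := Fin.ext (by simpa using h0)
      simpa using this
    have hk0 : (k : ℕ) ≠ 0 := fun h0 => hk (Fin.ext (by simpa using h0))
    unfold uFactorr
    rw [if_neg hk', if_neg hk0, S1r_neg, Sxir_neg_add_negFin]

/-- reflecting the `μ`-th alias index is an involution of the alias labels. [folklore] -/
theorem aliasReflect_involutive (R : ℕ) [NeZero R] (μ : Fin dd) : Function.Involutive (fun m : Fin dd → Fin R => Function.update m μ (-m μ)) := by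
  intro m
  simp only [Function.update_self, neg_neg, Function.update_idem, Function.update_eq_self]

/-- ★★ **THE RESCALED COMPOSED INVERSE SYMBOL IS EVEN IN EACH COORDINATE**: `composedInvResc c N M (update y μ (−y_μ)) = composedInvResc c N M y` (re-index the alias sum by
`l_μ ↦ −l_μ`). [cite: King1986, (4.12)–(4.13) p.671, (4.5) p.670] -/
theorem composedInvResc_update_neg (c : ℝ) (R : ℕ) [NeZero R] (Mt : ℝ) (y : Fin dd → ℝ) (μ : Fin dd) :
    composedInvResc c R Mt (Function.update y μ (-y μ)) = composedInvResc c R Mt y := by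
  unfold composedInvResc
  congr 1
  rw [← Equiv.sum_comp (Function.Involutive.toPerm _ (aliasReflect_involutive R μ))]
  refine Finset.sum_congr rfl fun m _ => ?_
  simp only [Function.Involutive.coe_toPerm]
  have hU : Ur R (Function.update m μ (-m μ)) (Function.update y μ (-y μ)) = Ur R m y := by
    unfold Ur
    refine Finset.prod_congr rfl fun ν _ => ?_
    by_cases hν : ν = μ
    · subst hν; simp only [Function.update_self, uFactorr_negFin_neg]
    · simp only [Function.update_of_ne hν]
  have hD : DeltaXir R Mt (shiftr R (Function.update m μ (-m μ)) (Function.update y μ (-y μ))) = DeltaXir R Mt (shiftr R m y) := by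
    unfold DeltaXir shiftr
    congr 1
    refine Finset.sum_congr rfl fun ν _ => ?_
    by_cases hν : ν = μ
    · subst hν; simp only [Function.update_self, Sxir_neg_add_negFin]
    · simp only [Function.update_of_ne hν]
  rw [hU, hD]

/-- ★★ **KING's ALIAS SYMBOL (4.5) IS EVEN IN EACH COORDINATE**: `Δ^{(K)}(update p μ (−p_μ)) = Δ^{(K)}(p)` (every `N ≥ 1`, real `a`, `M`). [cite: King1986, (4.5) p.670, (4.12) p.671] -/
theorem DeltaEff_update_neg (a : ℝ) (N : ℕ) [NeZero N] (M : ℝ) (p : Fin dd → ℝ) (μ : Fin dd) :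
    DeltaEff a N M (Function.update p μ (-p μ)) = DeltaEff a N M p := by
  unfold DeltaEff
  rw [composedInvResc_update_neg]

/-- ★★ `|p_μ| = |p′_μ|` for all `μ` ⇒ `Δ^{(K)}(p) = Δ^{(K)}(p′)` (iterate the single reflections). [cite: King1986, (4.5) p.670] -/
theorem DeltaEff_eq_of_abs_eq (a : ℝ) (N : ℕ) [NeZero N] (M : ℝ) {p p' : Fin dd → ℝ} (h : ∀ μ, |p μ| = |p' μ|) : DeltaEff a N M p = DeltaEff a N M p' := by
  -- induction on a set of coordinates outside which `p` and `p'` already agree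
  suffices key : ∀ (T : Finset (Fin dd)) (q : Fin dd → ℝ), (∀ μ, μ ∉ T → q μ = p' μ) → (∀ μ, |q μ| = |p' μ|) → DeltaEff a N M q = DeltaEff a N M p' from
    key Finset.univ p (fun μ hμ => absurd (Finset.mem_univ μ) hμ) h
  intro T
  induction T using Finset.induction_on with
  | empty =>
    intro q hq _
    have : q = p' := funext fun μ => hq μ (by simp)
    rw [this]
  | insert μ T hμT ih =>
    intro q hq habs
    -- move the `μ`-coordinate of `q` onto that of `p'`
    have hstep : DeltaEff a N M q = DeltaEff a N M (Function.update q μ (p' μ)) := by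
      rcases abs_eq_abs.mp (habs μ) with h1 | h1
      · rw [← h1, Function.update_eq_self]
      · have : Function.update q μ (p' μ) = Function.update q μ (-q μ) := by rw [h1, neg_neg]
        rw [this, DeltaEff_update_neg]
    rw [hstep]
    refine ih _ (fun ν hν => ?_) (fun ν => ?_)
    · by_cases hνμ : ν = μ
      · subst hνμ; simp only [Function.update_self]
      · rw [Function.update_of_ne hνμ]; exact hq ν (by simp [hνμ, hν])
    · by_cases hνμ : ν = μ
      · subst hνμ; simp only [Function.update_self]
      · rw [Function.update_of_ne hνμ]; exact habs ν

end Even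

/-! ## §3 The block-field symbol on the reflected half grid is the symbol on the shifted half grid -/

section HalfGrid

variable (n : Fin (d + 1) → ℕ) [hn : ∀ μ, NeZero (n μ)]

omit hn in
/-- `|valMinAbs((σ_S k̂)_μ)| = k_μ + [μ∈S]`. [folklore] -/
theorem natAbs_valMinAbs_torReflS_dblBox (S : Finset (Fin (d + 1))) (k : KingBox n) (μ : Fin (d + 1)) [NeZero (n μ)] :
    ((torReflS (dblPer n) S (dblBox n k) μ).valMinAbs.natAbs : ℕ) = (k μ).val + if μ ∈ S then 1 else 0 := by
  have hhalf : ∀ t : ℕ, t ≤ n μ → ((t : ZMod (2 * n μ))).valMinAbs = t := fun t ht => by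
    rw [ZMod.valMinAbs_natCast_of_le_half]
    rw [Nat.mul_div_cancel_left _ (by norm_num : 0 < 2)]
    exact ht
  by_cases hμ : μ ∈ S
  · have hrefl : torReflS (dblPer n) S (dblBox n k) μ = -((((k μ).val + 1 : ℕ)) : ZMod (2 * n μ)) := by
      simp only [torReflS, if_pos hμ, dblBox]
      push_cast
      ring
    rw [hrefl, ZMod.natAbs_valMinAbs_neg, hhalf _ (k μ).isLt, if_pos hμ]
    omega
  · have hrefl : torReflS (dblPer n) S (dblBox n k) μ = ((((k μ).val : ℕ)) : ZMod (2 * n μ)) := by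
      simp only [torReflS, if_neg hμ, dblBox]
    rw [hrefl, hhalf _ (k μ).isLt.le, if_neg hμ]
    omega

/-- ★ **THE REDUCED MOMENTA OF THE REFLECTED HALF GRID IN ABSOLUTE VALUE**: `|p′_μ(σ_S k̂)| = π(k_μ + [μ∈S])∕n_μ`. [cite: King1986, (4.1) p.670, §4 p.670] -/
theorem abs_sOf_torReflS_dblBox (S : Finset (Fin (d + 1))) (k : KingBox n) (μ : Fin (d + 1)) :
    |sOf (dblPer n) (torReflS (dblPer n) S (dblBox n k)) μ| = Real.pi * ((k μ).val + if μ ∈ S then (1 : ℝ) else 0) / n μ := by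
  have hn0 : (0 : ℝ) < n μ := by exact_mod_cast NeZero.pos (n μ)
  have hv : |(((torReflS (dblPer n) S (dblBox n k) μ).valMinAbs : ℤ) : ℝ)| = (k μ).val + if μ ∈ S then (1 : ℝ) else 0 := by
    rw [← Int.cast_abs, Int.abs_eq_natAbs, Int.cast_natCast, natAbs_valMinAbs_torReflS_dblBox n S k μ]
    split_ifs <;> push_cast <;> ring
  unfold sOf
  simp only [dblPer]
  rw [abs_div, abs_mul, abs_of_pos (by positivity : (0 : ℝ) < 2 * Real.pi), show (((torReflS (fun μ => 2 * n μ) S (dblBox n k) μ).valMinAbs : ℤ) : ℝ)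
      = (((torReflS (dblPer n) S (dblBox n k) μ).valMinAbs : ℤ) : ℝ) from rfl, hv]
  push_cast
  rw [abs_of_pos (by positivity : (0 : ℝ) < 2 * (n μ : ℝ)), mul_assoc, mul_div_mul_left _ _ (two_ne_zero' ℝ)]

omit hn in
/-- the shifted half-grid points have non-negative coordinates. [folklore] -/
theorem boxShiftPt_nonneg (S : Finset (Fin (d + 1))) (k : KingBox n) (μ : Fin (d + 1)) : 0 ≤ boxShiftPt n S k μ := by
  simp only [boxShiftPt]
  apply div_nonneg _ (Nat.cast_nonneg _)
  apply mul_nonneg Real.pi_pos.le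
  split_ifs <;> positivity

/-- ★★ **KING's BLOCK-FIELD SYMBOL ON THE REFLECTED HALF GRID IS THE SYMBOL ON THE SHIFTED HALF GRID**: `Δ^{(K)}(p′(σ_S k̂)) = Δ^{(K)}((π(k_ν+[ν∈S])∕n_ν)_ν)` (every `N ≥ 1`,
real `a`, `M`). [cite: King1986, (4.5) p.670, §4 p.670 l.8–13] -/
theorem DeltaEff_sOf_torReflS_dblBox (a : ℝ) (N : ℕ) [NeZero N] (M : ℝ) (S : Finset (Fin (d + 1))) (k : KingBox n) :
    DeltaEff a N M (sOf (dblPer n) (torReflS (dblPer n) S (dblBox n k))) = DeltaEff a N M (boxShiftPt n S k) :=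
  DeltaEff_eq_of_abs_eq a N M fun μ => by
    rw [abs_sOf_torReflS_dblBox, abs_of_nonneg (boxShiftPt_nonneg n S k μ)]
    simp only [boxShiftPt]

end HalfGrid

end Summit.QuantumFields.YangMills.BalabanUVNodes.N15KingModelRung.TorusSpectral

end
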